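import Summits.CriticalPhenomena.SAWScalingLimit.Theorems.SAWLoopFugacityFlowSimpleSubseqLimitsFarReturnPassage
import Summits.CriticalPhenomena.SAWScalingLimit.Theorems.SAWLoopFugacityFlowSimpleSubseqLimitsLatticeLine
import HarnessLib

/-!
# The lattice line v4 of the crux `SimpleSubseqLimits`: BOUNDARY AVOIDANCE, TWICE
(crux stmt-CriticalPhenomena-4982, decl `Summit.CriticalPhenomena.SAWScalingLimit.Theses.SAWLoopFugacityFlow.SimpleSubseqLimits`;
line `past-shadowing-costs-halves`, reshaping v4; line lead c4, 2026-08-17)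

§1 THE LINE.  `line_farReturn : FarReturnDecay → BoundaryDecay → SimpleSubseqLimits` — the crux from two
pure lattice statements about the critical `δℤ²` SAW law, both of them AVOIDANCE statements: the walk
avoids the domain boundary away from the marked points (`Boundary.Passage.BoundaryDecay`, lead c3), and,
after its first entrance into any ball, it avoids the far part of its own past
(`FarPast.Passage.FarReturnDecay`, this seat: a one-stopping-time past/future event,
`FarPast.Passage.nearFarReturn_pastFuture`). No route item is used.

§2 THE PINS OF THE NEW ORDER INPUT.  `farReturnDecay_of_firstHitDecay : FirstHitDecay → FarReturnDecay`
(the new input is WEAKER than c2's first-hit input: a thickened far return is a thickened first-hit return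
with separation `3r`, `FarPast.Passage.nearFarReturn_nearFirstHitReturn`), hence
`farReturnDecay_of_sawScalingLimit` (summit-implied) and `farReturnDecay_of_crux` (necessary given
`EventualTight`).

§3 THE RESIDUAL CERTIFICATE.  `crux_iff_farLattice : EventualTight → (SimpleSubseqLimits ↔
FarReturnDecay ∧ BoundaryDecay)`.  §3b THE LATTICE PROVER'S TARGET: `PastFutureAvoidance` — small
probability of a past/future return AT THE FIRST ENTRANCE into `B̄(q, r')` (polyline-level, the event the
exact domain Markov property acts on; "the slit-graph SAW avoids the far slit", averaged over the past) —
and `farReturnDecay_of_pastFutureAvoidance : PastFutureAvoidance → FarReturnDecay` (sufficient form).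

§4 THE PROMOTABLE ITEM, self-contained: `LatticeAvoidance` (both events inlined, Literature vocabulary
only), `latticeAvoidance_iff := Iff.rfl`, glue `simpleSubseqLimits_of_latticeAvoidance`, pins
`crux_iff_latticeAvoidance`, `latticeAvoidance_of_sawScalingLimit`, and the comparison with c3's item
`latticeAvoidance_of_latticeInputs : Boundary.Line.LatticeInputs → LatticeAvoidance`.
-/

noncomputable section

open MeasureTheory Filter Topology Set Metric Function
open Literature.Probability.RandomPlanarGeometry Literature.Probability.RandomPlanarGeometry.SAW
open Literature.Probability.LatticeModels
open scoped ENNReal NNReal BoundedContinuousFunction unitInterval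

namespace Summit.CriticalPhenomena.SAWScalingLimit.Theorems.SimpleSubseqLimits.FarPast.Line

open Summit.CriticalPhenomena.SAWScalingLimit.Theses.SAWLoopFugacityFlow (SimpleSubseqLimits EventualTight)
open Summit.CriticalPhenomena.SAWScalingLimit.Theorems.SimpleSubseqLimits.Negative
  (simpleSubseqLimits_iff_core)
open Summit.CriticalPhenomena.SAWScalingLimit.Theorems.SimpleSubseqLimits.MarkedPointRevisit.Passage
  (IsSubseqLimit latticeCurve)
open Summit.CriticalPhenomena.SAWScalingLimit.Theorems.SimpleSubseqLimits.FirstHit.Passage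
  (NearFirstHitReturn nearFirstHitReturnEvent FirstHitDecay)
open Summit.CriticalPhenomena.SAWScalingLimit.Theorems.SimpleSubseqLimits.FirstHit.Line
  (firstHitDecay_of_sawScalingLimit firstHitDecay_of_crux)
open Summit.CriticalPhenomena.SAWScalingLimit.Theorems.SimpleSubseqLimits.Boundary.Passage
  (BoundaryDecay ae_boundary_of_boundaryDecayAt)
open Summit.CriticalPhenomena.SAWScalingLimit.Theorems.SimpleSubseqLimits.Boundary.Line
  (LatticeInputs latticeInputs_iff boundaryDecay_of_sawScalingLimit boundaryDecay_of_crux)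
open Summit.CriticalPhenomena.SAWScalingLimit.Theorems.SimpleSubseqLimits.FarPast.Passage
  (NearFarReturn nearFarReturnEvent FarReturnDecayAt FarReturnDecay ae_simple_of_farReturnDecayAt
    nearFarReturn_nearFirstHitReturn nearFarReturn_pastFuture setOf_nearFarReturn_latticeCurve)

/-! ## §1 The line: crux ⇐ far-return decay ∧ boundary decay (no route item) -/

/-- **THE LATTICE LINE v4** for the crux `SimpleSubseqLimits` (all four routes wanting
stmt-CriticalPhenomena-4982): far-return decay (ORDER, first-entrance slit avoidance) and boundary decay
(BOUNDARY) give the crux — `ν`-a.s. simple by `FarPast.Passage.ae_simple_of_farReturnDecayAt`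
(guarded Rohde–Schramm, no SHAPE), the boundary clause by `Boundary.Passage.ae_boundary_of_boundaryDecayAt`,
the rest free (`Negative.simpleSubseqLimits_iff_core`). No route item is used. [folklore] -/
theorem line_farReturn (hF : FarReturnDecay) (hB : BoundaryDecay) : SimpleSubseqLimits := by
  refine simpleSubseqLimits_iff_core.2 fun D a b hab s ν hs hν hw => ?_
  have hsimple := ae_simple_of_farReturnDecayAt hab (hF D a b hab) ⟨hs, hν, hw⟩
  have hbd := ae_boundary_of_boundaryDecayAt (hB D a b hab) (⟨hs, hν, hw⟩ : IsSubseqLimit D a b s ν)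
  filter_upwards [hsimple, hbd] with c h1 h2
  exact ⟨h1, h2⟩

/-! ## §2 The pins of the far-return input -/

/-- **The far-return input is WEAKER than the first-hit input**: `FirstHitDecay → FarReturnDecay`.
Given `(q, r, θ)`, apply first-hit decay with separation `ρ = 3r` to get `(ε, R')`; then the radii
`r₀ = r/2`, `r' = min R' (2r)` witness far-return decay, because every thickened far return at
`(q, r/2, r, r', ε)` is a thickened first-hit return at `(q, r, R', 3r, ε)`
(`nearFarReturn_nearFirstHitReturn`). [folklore] -/
theorem farReturnDecay_of_firstHitDecay (hF : FirstHitDecay) : FarReturnDecay := by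
  intro D a b hab q r θ hr hθ
  obtain ⟨ε, R', hε, hR', hev⟩ := hF D a b hab q r (3 * r) θ hr (by positivity) hθ
  refine ⟨ε, r / 2, min R' (2 * r), hε, by positivity, by linarith, lt_min hR' (by linarith), ?_⟩
  filter_upwards [hev] with δ hδ
  refine le_trans (measure_mono ?_) hδ
  rintro γ ⟨γ', hγ', h⟩
  exact ⟨γ', hγ', nearFarReturn_nearFirstHitReturn hr.le (min_le_right _ _) (min_le_left _ _) h⟩

/-- **`FarReturnDecay` is implied by the summit conjecture** `SAWScalingLimit` (not over-strong).
[folklore] -/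
theorem farReturnDecay_of_sawScalingLimit (h : _root_.SAWScalingLimit) : FarReturnDecay :=
  farReturnDecay_of_firstHitDecay (firstHitDecay_of_sawScalingLimit h)

/-- **`FarReturnDecay` is NECESSARY for the crux given `EventualTight`.** [folklore] -/
theorem farReturnDecay_of_crux (hT : EventualTight) (hS : SimpleSubseqLimits) : FarReturnDecay :=
  farReturnDecay_of_firstHitDecay (firstHitDecay_of_crux hT hS)

/-! ## §3 The residual certificate -/

/-- **RESIDUAL CERTIFICATE (v4).** Under `EventualTight` the crux IS the conjunction of the two
avoidance inputs: `SimpleSubseqLimits ↔ FarReturnDecay ∧ BoundaryDecay`. No A-side item enters.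
[folklore] -/
theorem crux_iff_farLattice (hT : EventualTight) : SimpleSubseqLimits ↔ FarReturnDecay ∧ BoundaryDecay :=
  ⟨fun hS => ⟨farReturnDecay_of_crux hT hS, boundaryDecay_of_crux hT hS⟩,
    fun h => line_farReturn h.1 h.2⟩

/-- **Both avoidance inputs are implied by the summit conjecture.** [folklore] -/
theorem farLattice_of_sawScalingLimit (h : _root_.SAWScalingLimit) : FarReturnDecay ∧ BoundaryDecay :=
  ⟨farReturnDecay_of_sawScalingLimit h, boundaryDecay_of_sawScalingLimit h⟩

/-- The v4 inputs are implied by the v3 inputs (`FirstHitDecay ∧ BoundaryDecay`, c3's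
`Boundary.Line.LatticeInputs`). [folklore] -/
theorem farLattice_of_lattice (h : FirstHitDecay ∧ BoundaryDecay) : FarReturnDecay ∧ BoundaryDecay :=
  ⟨farReturnDecay_of_firstHitDecay h.1, h.2⟩

/-! ## §3b The lattice prover's target: PAST/FUTURE AVOIDANCE AT THE FIRST ENTRANCE (sufficient form) -/

/-- **Past/future return at the first entrance into `B̄(q, r')`** (polyline-level event, the form the
exact domain Markov property acts on): with `τ` the FIRST hitting time of `B̄(q, r')`, some earlier value
`γ v` — taken while the curve was outside the guard ball `B̄(q, 5r)` — is revisited `ε`-closely at a time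
`t' ≥ τ`. Not an open condition (first hitting times jump); used only as an UPPER bound for the open
far-return event. [folklore] -/
def PastFutureReturn (γ : Curve ℂ) (q : ℂ) (r r' ε : ℝ) : Prop :=
  ∃ v τ t' : I, v < τ ∧ τ ≤ t' ∧ γ τ ∈ closedBall q r' ∧ (∀ u : I, u < τ → γ u ∉ closedBall q r') ∧
    (∀ u : I, u ≤ v → 5 * r < dist (γ u) q) ∧ dist (γ t') (γ v) < ε

/-- **Past/future avoidance at `(D; a_δ, b_δ)`**: for every `q`, `r > 0`, `θ > 0` there are `ε > 0` and
`r' ∈ (r, 5r]` such that, for all small meshes, with probability `≤ θ` the lattice polyline has a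
past/future return at its first entrance into `B̄(q, r')`. By the exact domain Markov property at the first
vertex in `B̄(q, r')` this is a statement about the critical SAW of the SLIT graph `Ω_δ ∖ γ[0, τ)` started
at the tip: it does not come `ε`-close to the part of the slit outside the guard ball — LSW's heuristic
"the rest of the walk avoids its past as it avoids the boundary" (LSW04 §3.4.5), averaged over the past.
An open statement (untagged); SUFFICIENT for `FarReturnDecayAt` (`farReturnDecay_of_pastFutureAvoidance`). -/
def PastFutureAvoidanceAt (D : DobrushinDomain) (a b : ℝ → Site 2) : Prop :=
  ∀ (q : ℂ) (r θ : ℝ), 0 < r → 0 < θ → ∃ ε r' : ℝ, 0 < ε ∧ r < r' ∧ r' ≤ 5 * r ∧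
    ∀ᶠ δ in 𝓝[>] (0 : ℝ),
      SAW.law D.carrier δ (a δ) (b δ) {γ | PastFutureReturn (latticeCurve γ) q r r' ε} ≤
        ENNReal.ofReal θ

/-- Past/future avoidance along every endpoint approximation (open, untagged; sufficient for
`FarReturnDecay`). -/
def PastFutureAvoidance : Prop :=
  ∀ (D : DobrushinDomain) (a b : ℝ → Site 2), SAW.IsEndpointApprox D a b → PastFutureAvoidanceAt D a b

/-- A thickened far return with `r' ≤ 5r` IS a past/future return at the first entrance into `B̄(q, r')`
(`FarPast.Passage.nearFarReturn_pastFuture`). [folklore] -/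
theorem pastFutureReturn_of_nearFarReturn {γ : Curve ℂ} {q : ℂ} {r₀ r r' ε : ℝ} (h5 : r' ≤ 5 * r)
    (h : NearFarReturn γ q r₀ r r' ε) : PastFutureReturn γ q r r' ε := by
  obtain ⟨v, τ, t', hvτ, hτt, hτ, hfirst, hguard, -, hret⟩ := nearFarReturn_pastFuture h5 h
  exact ⟨v, τ, t', hvτ, hτt, hτ, hfirst, hguard, hret⟩

/-- **Past/future avoidance ⇒ far-return decay** (so a lattice proof of the averaged slit-avoidance
statement closes the ORDER half of the crux): take `r₀ = r/2` and the `(ε, r')` of the hypothesis; the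
open far-return event of the polyline is contained in the past/future event. [folklore] -/
theorem farReturnDecay_of_pastFutureAvoidance (h : PastFutureAvoidance) : FarReturnDecay := by
  intro D a b hab q r θ hr hθ
  obtain ⟨ε, r', hε, hr', h5, hev⟩ := h D a b hab q r θ hr hθ
  refine ⟨ε, r / 2, r', hε, by positivity, by linarith, hr', ?_⟩
  filter_upwards [hev] with δ hδ
  refine le_trans (measure_mono fun γ hγ => ?_) hδ
  have hγ' : γ ∈ {γ : SAW.DomainSAW D.carrier δ (a δ) (b δ) |
      NearFarReturn (latticeCurve γ) q (r / 2) r r' ε} := by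
    rw [setOf_nearFarReturn_latticeCurve]
    exact hγ
  exact pastFutureReturn_of_nearFarReturn h5 hγ'

/-- Hence past/future avoidance and boundary decay close the crux. [folklore] -/
theorem simpleSubseqLimits_of_pastFutureAvoidance (h : PastFutureAvoidance) (hB : BoundaryDecay) :
    SimpleSubseqLimits :=
  line_farReturn (farReturnDecay_of_pastFutureAvoidance h) hB

/-! ## §4 The promotable item, self-contained (events inlined, Literature vocabulary only) -/

/-- **BOUNDARY AVOIDANCE, TWICE — the two lattice inputs of the crux as ONE self-contained statement**
(`FarReturnDecay ∧ BoundaryDecay` with the vocabulary of `FarPast.Passage` / `Boundary.Passage`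
INLINED, so that it elaborates in a route file): (i) far-return decay — for every closed ball
`B̄(q, r)` and target `θ` there are a width `ε` and radii `0 < r₀ < r < r'` such that, eventually as
`δ → 0⁺`, with probability `≤ θ` some representative of the walk's curve class has times `v < T ≤ t'`
with the curve outside the guard ball `B̄(q, 5r)` on `[0, v]`, outside `B̄(q, r₀)` on `[0, T]`, inside
`B(q, r')` at `T`, and `ε`-close to `γ v` at `t'` (for `r' ≤ 5r` a past/future event at the first
entrance into `B̄(q, r')`: the conditioned walk approaches the far part of its slit); (ii) boundary
decay — for every `ρ, θ` there is `ε` such that, eventually, with probability `≤ θ` some representative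
visits the open `ε`-neighbourhood of `∂D` at a point `ρ`-far from both marked points. An open statement
of this crux (the form recommended for promotion, v4) — deliberately untagged: not a literature fact. -/
def LatticeAvoidance : Prop :=
  (∀ (D : DobrushinDomain) (a b : ℝ → Site 2), SAW.IsEndpointApprox D a b →
    ∀ (q : ℂ) (r θ : ℝ), 0 < r → 0 < θ → ∃ ε r₀ r' : ℝ, 0 < ε ∧ 0 < r₀ ∧ r₀ < r ∧ r < r' ∧
      ∀ᶠ δ in 𝓝[>] (0 : ℝ),
        SAW.law D.carrier δ (a δ) (b δ) {γ | ∃ γ' : Curve ℂ, CurveClass.mk γ' = γ.curve ∧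
          ∃ v T t' : I, v < T ∧ T ≤ t' ∧ (∀ u : I, u ≤ v → 5 * r < dist (γ' u) q) ∧
            (∀ u : I, u ≤ T → r₀ < dist (γ' u) q) ∧ dist (γ' T) q < r' ∧
              dist (γ' t') (γ' v) < ε} ≤ ENNReal.ofReal θ) ∧
  (∀ (D : DobrushinDomain) (a b : ℝ → Site 2), SAW.IsEndpointApprox D a b →
    ∀ ρ θ : ℝ, 0 < ρ → 0 < θ → ∃ ε : ℝ, 0 < ε ∧
      ∀ᶠ δ in 𝓝[>] (0 : ℝ),
        SAW.law D.carrier δ (a δ) (b δ) {γ | ∃ γ' : Curve ℂ, CurveClass.mk γ' = γ.curve ∧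
          ∃ t : I, infDist (γ' t) (frontier D.carrier) < ε ∧ ρ < dist (γ' t) (D.pt 0) ∧
            ρ < dist (γ' t) (D.pt 1)} ≤ ENNReal.ofReal θ)

/-- The self-contained statement IS the conjunction of the two avoidance inputs (definitional).
[folklore] -/
theorem latticeAvoidance_iff : LatticeAvoidance ↔ FarReturnDecay ∧ BoundaryDecay := Iff.rfl

/-- **Glue for the promoted item (v4)**: the self-contained avoidance statement proves the crux.
[folklore] -/
theorem simpleSubseqLimits_of_latticeAvoidance (h : LatticeAvoidance) : SimpleSubseqLimits :=
  line_farReturn (latticeAvoidance_iff.1 h).1 (latticeAvoidance_iff.1 h).2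

/-- … it is equivalent to the crux modulo `EventualTight` … [folklore] -/
theorem crux_iff_latticeAvoidance (hT : EventualTight) : SimpleSubseqLimits ↔ LatticeAvoidance :=
  (crux_iff_farLattice hT).trans latticeAvoidance_iff.symm

/-- … implied by the summit conjecture … [folklore] -/
theorem latticeAvoidance_of_sawScalingLimit (h : _root_.SAWScalingLimit) : LatticeAvoidance :=
  latticeAvoidance_iff.2 (farLattice_of_sawScalingLimit h)

/-- … and implied by c3's promotable statement `Boundary.Line.LatticeInputs` (v3): the v4 item is the
weaker of the two. [folklore] -/
theorem latticeAvoidance_of_latticeInputs (h : LatticeInputs) : LatticeAvoidance :=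
  latticeAvoidance_iff.2 (farLattice_of_lattice (latticeInputs_iff.1 h))

/-- **Registered form (stub `stub_farReturnLine` of the crux item stmt-CriticalPhenomena-4982).** The
v4 lattice line: the crux from its two avoidance inputs. [folklore] -/
theorem stub_farReturnLine : FarReturnDecay → BoundaryDecay → SimpleSubseqLimits :=
  line_farReturn

end Summit.CriticalPhenomena.SAWScalingLimit.Theorems.SimpleSubseqLimits.FarPast.Line

end
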